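import Summits.Ventures.CertifiedManyBodySolver.Theorems.TcThermcert1GcLocalTraces
import Literature.MathematicalPhysics.QuantumLattice.HubbardWave0LiebProofs
import Mathlib
import HarnessLib

/-!
# Unfusing the local two-fugacity Gibbs factor: joint analyticity in the fugacities (K2 groundwork, part 8)

Helper file for route `TcThermcert1`, crux `ThermalStiffnessCeilingU8b10_le_1o8` (item `stmt-Ventures-26381`), line
`Cruxes/ThermalStiffnessCeilingU8b10_le_1o8/Lines/zerofree_corridor.lean` v9, registered stub K2 `stub_gcHighTempAnalytic`, steps S4/S6 of
`Cruxes/…/STUB-PLAN-stub_gcHighTempAnalytic.md` (generalisation (G3): JOINT analyticity in `(ζ↑, ζ↓)`).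

The fused form `exp(−βV_A + F_A(z,w) + Σ_b c_b T_b)` of parts 1–7 carries `Complex.log z`, `Complex.log w`, which are NOT analytic across the
negative real axis — and the annulus `2/3 < |ζ| < 8/9` of the stub crosses it. This file removes the logarithms from the LOCAL factors:

* §1 `Σ_b c_b T_b` conserves `N↑, N↓` (`preservesSectors_hopSum`) and, for couplings on bonds inside `A`, commutes with the LOCAL
  log-fugacity operator `F_A(z,w) = Σ_{x∈A}(log z · n_{x↑} + log w · n_{x↓})` (`commute_hopSum_sum_logFugacity`: `F_Λ` is a function of
  the sectors, `F_{Aᶜ}` lives on the complementary orbitals and is even, `F_A = F_Λ − F_{Aᶜ}`); so does `−βV_A` (two diagonal matrices);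
* §2 hence `tr exp(−βV_A + F_A + Σ c_b T_b) = tr( diag(∏_{x∈A} z^{[x↑∈s]} w^{[x↓∈s]}) · exp(−βV_A + Σ c_b T_b) )`
  (`trace_exp_twoFugacityLocal_hopSum_eq`) — a POLYNOMIAL in `(z, w)` — and the map
  `(ζ↑, ζ↓) ↦ tr( diag(∏_{x∈A} ζ↑^{[x↑∈s]} ζ↓^{[x↓∈s]}) · exp(−βV_A + Σ c_b T_b) )` is jointly analytic on all of
  `ℂ²` (`analyticOnNhd_localFugacityTrace`).

[cite: Ueltschi1999, §2.1 (fugacity expansion of the local traces)] Finite-dimensional linear algebra; no physics claim — nothing about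
superconductivity in the Hubbard model is proved by anything in this file. No definitions; no `sorry`.
-/

noncomputable section

namespace Summit.Ventures.CertifiedManyBodySolver.Theorems.TcThermcert1.ZeroFreeCorridor

open Matrix Finset Complex
open Literature.MathematicalPhysics.QuantumLattice

variable {Λ : Type*} [LinearOrder Λ] [Fintype Λ]

/-! ## §1 Commutation of the hopping with the local log-fugacity operator -/

/-- `Σ_b c_b T_b` conserves `N↑` and `N↓` (each `T_b = c†_{xσ} c_{yσ}` does). -/
theorem preservesSectors_hopSum (c : Bond Λ → ℂ) : PreservesSectors (hopSum c) :=
  PreservesSectors.sum fun b _ => (LiebThm1.preservesSectors_hopping b.1 b.2.1 b.2.2).smul (c b)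

/-- The hopping commutes with the GLOBAL log-fugacity operator `F_Λ(z,w) = log z · N↑ + log w · N↓`. -/
theorem commute_hopSum_sum_logFugacity_univ (c : Bond Λ → ℂ) (z w : ℂ) :
    Commute (hopSum c) (∑ x ∈ (univ : Finset Λ), (Complex.log z • numberOp x 0 + Complex.log w • numberOp x 1)) := by
  classical
  rw [sum_logFugacity_univ_eq_diagonal]
  exact (preservesSectors_hopSum c).commute_diagonal fun a b => (a : ℂ) * Complex.log z + (b : ℂ) * Complex.log w

/-- For couplings on bonds inside `A`, the hopping commutes with the log-fugacity operator of the COMPLEMENT `F_{Aᶜ}` (disjoint supports,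
even operators). -/
theorem commute_hopSum_sum_logFugacity_compl {A : Finset Λ} {c : Bond Λ → ℂ} (hc : ∀ b, c b ≠ 0 → b.1 ∈ A ∧ b.2.1 ∈ A) (z w : ℂ) :
    Commute (hopSum c) (∑ x ∈ Aᶜ, (Complex.log z • numberOp x 0 + Complex.log w • numberOp x 1)) :=
  commute_of_mem_carEvenSubalgebra (hopSum_mem hc)
    (carEvenSubalgebra_le_carSubalgebra _ (sum_logFugacity_mem z w (subset_refl Aᶜ))) (disjoint_orbs disjoint_compl_right)

/-- For couplings on bonds inside `A`, the hopping commutes with the LOCAL log-fugacity operator `F_A(z,w)`. -/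
theorem commute_hopSum_sum_logFugacity {A : Finset Λ} {c : Bond Λ → ℂ} (hc : ∀ b, c b ≠ 0 → b.1 ∈ A ∧ b.2.1 ∈ A) (z w : ℂ) :
    Commute (hopSum c) (∑ x ∈ A, (Complex.log z • numberOp x 0 + Complex.log w • numberOp x 1)) := by
  have h := (commute_hopSum_sum_logFugacity_univ c z w).sub_right (commute_hopSum_sum_logFugacity_compl hc z w)
  rwa [sum_logFugacity_univ_eq_add_compl z w A, add_sub_cancel_right] at h

/-- The on-site interaction `−βV_A` commutes with `F_A(z,w)` (two diagonal matrices). -/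
theorem commute_neg_smul_onSiteSum_sum_logFugacity (β U : ℂ) (A : Finset Λ) (z w : ℂ) :
    Commute (-(β • onSiteSum U 0 A)) (∑ x ∈ A, (Complex.log z • numberOp x 0 + Complex.log w • numberOp x 1)) := by
  classical
  rw [onSiteSum_eq_diagonal, sum_logFugacity_eq_diagonal,
    show (-(β • diagonal fun s : Finset (Orb Λ) => ∑ x ∈ A, onSiteEnergyAt U 0 x s)) =
      diagonal (fun s => -(β * ∑ x ∈ A, onSiteEnergyAt U 0 x s)) by rw [← diagonal_smul, ← diagonal_neg]; rfl]
  rw [Commute, SemiconjBy, diagonal_mul_diagonal, diagonal_mul_diagonal]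
  congr 1
  funext s
  ring

/-! ## §2 The unfused local trace and its joint analyticity in the fugacities -/

/-- `exp(F_A(z,w)) = diag(∏_{x∈A} z^{[x↑∈s]} w^{[x↓∈s]})` for `z, w ≠ 0`. -/
theorem exp_sum_logFugacity_eq_diagonal {z w : ℂ} (hz : z ≠ 0) (hw : w ≠ 0) (A : Finset Λ) :
    NormedSpace.exp (∑ x ∈ A, (Complex.log z • numberOp x 0 + Complex.log w • numberOp x 1)) =
      diagonal (fun s : Finset (Orb Λ) =>
        ∏ x, if x ∈ A then (if x ∈ upPart s then z else 1) * (if x ∈ downPart s then w else 1) else 1) := by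
  classical
  rw [sum_logFugacity_eq_diagonal, Matrix.exp_diagonal]
  congr 1
  funext s
  rw [Pi.exp_def]
  dsimp only
  rw [← Complex.exp_eq_exp_ℂ, cexp_sum_logFugacityAt hz hw]

/-- **Unfused local trace**: for `z, w ≠ 0` and couplings on bonds inside `A`,
`tr exp(−βV_A + F_A(z,w) + Σ_b c_b T_b) = tr( diag(∏_{x∈A} z^{[x↑∈s]} w^{[x↓∈s]}) · exp(−βV_A + Σ_b c_b T_b) )` —
a polynomial in `(z, w)`. -/
theorem trace_exp_twoFugacityLocal_hopSum_eq {z w : ℂ} (β U : ℂ) (hz : z ≠ 0) (hw : w ≠ 0) {A : Finset Λ} {c : Bond Λ → ℂ}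
    (hc : ∀ b, c b ≠ 0 → b.1 ∈ A ∧ b.2.1 ∈ A) :
    (NormedSpace.exp (-(β • onSiteSum U 0 A) + (∑ x ∈ A, (Complex.log z • numberOp x 0 + Complex.log w • numberOp x 1)) +
        hopSum c)).trace =
      (diagonal (fun s : Finset (Orb Λ) =>
          ∏ x, if x ∈ A then (if x ∈ upPart s then z else 1) * (if x ∈ downPart s then w else 1) else 1) *
        NormedSpace.exp (-(β • onSiteSum U 0 A) + hopSum c)).trace := by
  classical
  have hcomm : Commute (∑ x ∈ A, (Complex.log z • numberOp x 0 + Complex.log w • numberOp x 1))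
      (-(β • onSiteSum U 0 A) + hopSum c) :=
    ((commute_neg_smul_onSiteSum_sum_logFugacity β U A z w).symm).add_right (commute_hopSum_sum_logFugacity hc z w).symm
  rw [show -(β • onSiteSum U 0 A) + (∑ x ∈ A, (Complex.log z • numberOp x 0 + Complex.log w • numberOp x 1)) + hopSum c =
      (∑ x ∈ A, (Complex.log z • numberOp x 0 + Complex.log w • numberOp x 1)) + (-(β • onSiteSum U 0 A) + hopSum c) by abel,
    Matrix.exp_add_of_commute _ _ hcomm, exp_sum_logFugacity_eq_diagonal hz hw]

/-- **Joint analyticity of the unfused local trace**: for any fixed matrix `E`,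
`(ζ↑, ζ↓) ↦ tr( diag(∏_{x∈A} ζ↑^{[x↑∈s]} ζ↓^{[x↓∈s]}) · E )` is analytic on all of `ℂ × ℂ` (it is a polynomial). With
`E = exp(−βV_A + Σ_b c_b T_b)` and `trace_exp_twoFugacityLocal_hopSum_eq` this is the joint analyticity of the local two-fugacity Gibbs
factors in the fugacities, with no branch cut. -/
theorem analyticOnNhd_localFugacityTrace (A : Finset Λ) (E : Matrix (Finset (Orb Λ)) (Finset (Orb Λ)) ℂ) :
    AnalyticOnNhd ℂ (fun ζ : ℂ × ℂ =>
      (diagonal (fun s : Finset (Orb Λ) =>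
          ∏ x, if x ∈ A then (if x ∈ upPart s then ζ.1 else 1) * (if x ∈ downPart s then ζ.2 else 1) else 1) * E).trace)
      Set.univ := by
  classical
  have htr : ∀ ζ : ℂ × ℂ, (diagonal (fun s : Finset (Orb Λ) =>
      ∏ x, if x ∈ A then (if x ∈ upPart s then ζ.1 else 1) * (if x ∈ downPart s then ζ.2 else 1) else 1) * E).trace =
      ∑ s, (∏ x, if x ∈ A then (if x ∈ upPart s then ζ.1 else 1) * (if x ∈ downPart s then ζ.2 else 1) else 1) * E s s := by
    intro ζ
    rw [Matrix.trace]
    refine Finset.sum_congr rfl fun s _ => ?_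
    rw [Matrix.diag_apply, diagonal_mul]
  simp_rw [htr]
  refine Finset.analyticOnNhd_fun_sum _ fun s _ => ?_
  refine AnalyticOnNhd.mul (Finset.analyticOnNhd_fun_prod _ fun x _ => ?_) analyticOnNhd_const
  by_cases hx : x ∈ A
  · simp only [hx, if_true]
    refine AnalyticOnNhd.mul ?_ ?_
    · by_cases h : x ∈ upPart s
      · simp only [h, if_true]; exact analyticOnNhd_fst
      · simp only [h, if_false]; exact analyticOnNhd_const
    · by_cases h : x ∈ downPart s
      · simp only [h, if_true]; exact analyticOnNhd_snd
      · simp only [h, if_false]; exact analyticOnNhd_const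
  · simp only [hx, if_false]
    exact analyticOnNhd_const

end Summit.Ventures.CertifiedManyBodySolver.Theorems.TcThermcert1.ZeroFreeCorridor

end
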